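import Literature.NumberTheory.Automorphic.LevelActionAnnihilatorTransport
import HarnessLib

/-!
# The ordinary part of a finite module: the stabilising projector trick

Topic `NumberTheory/Automorphic`; namespace `Literature.NumberTheory.Automorphic.OrdFinite`;
theorems only (no new definitions, no named fact, no `sorry`).

For a finite module `M` with a finite commuting family of operators `U_v`, the ordinary part
`Ord = ⋂_v ⋂ₘ range U_vᵐ` is the range of `P = ∏_v U_v^N` for `N` large, and `P` is bijective on
`Ord` and commutes with every operator commuting with the `U_v` (`exists_stabilising`).  Consequence
(`exists_forall_mem_iInf_eq_sum`): **if `x ∈ Ord` is of the form `∑_i G_i y_i` with `G_i` commuting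
with the `U_v`, then `x = ∑_i G_i z_i` with all `z_i ∈ Ord`** — i.e. `Ord ∩ I·M = I·Ord` for an
ideal `I` of operators commuting with the `U_v` (the substitute for the ordinary idempotent
`e = lim U_p^{n!}` on finite coefficients).

[cite: Hida1994AIF, §2 (the idempotent e)] [cite: KhareThorne2017, §2.4]

## References

* H. Hida, Ann. Inst. Fourier 44 (1994), §2. [Hida1994AIF]
* C. Khare, J. A. Thorne, Amer. J. Math. 139 (2017), §2.4. [KhareThorne2017]
-/

noncomputable section

namespace Literature.NumberTheory.Automorphic

namespace OrdFinite

variable {R : Type} [CommRing R] {M : Type} [AddCommGroup M] [Module R M] {𝒱 : Type} [Fintype 𝒱]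

/-- A product of operators each injective on `S` and mapping `S` into `S` is injective on `S`.
[folklore] -/
theorem injOn_noncommProd {α : Type} (s : Finset α) (f : α → Module.End R M)
    (comm : (s : Set α).Pairwise fun a b => Commute (f a) (f b)) (S : Set M)
    (hmaps : ∀ a ∈ s, Set.MapsTo (f a) S S) (hinj : ∀ a ∈ s, Set.InjOn (f a) S) :
    Set.InjOn (⇑(s.noncommProd f comm)) S ∧ Set.MapsTo (⇑(s.noncommProd f comm)) S S := by
  classical
  induction s using Finset.induction_on with
  | empty =>
    rw [Finset.noncommProd_empty]
    exact ⟨fun x _ y _ h => h, fun x hx => hx⟩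
  | @insert a s ha ih =>
    obtain ⟨hinj', hmaps'⟩ := ih (comm.mono fun _ => Finset.mem_insert_of_mem)
      (fun b hb => hmaps b (Finset.mem_insert_of_mem hb)) (fun b hb => hinj b (Finset.mem_insert_of_mem hb))
    rw [Finset.noncommProd_insert_of_notMem _ _ _ _ ha, Module.End.mul_eq_comp, LinearMap.coe_comp]
    exact ⟨(hinj a (Finset.mem_insert_self a s)).comp hinj' hmaps',
      (hmaps a (Finset.mem_insert_self a s)).comp hmaps'⟩

/-- **The stabilising operator `P = ∏_v U_v^N`**: it commutes with everything commuting with the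
`U_v`, its range lies in `Ord = ⋂_v ⋂ₘ range U_vᵐ`, and it is bijective on `Ord` (finite `M`).
[cite: Hida1994AIF, §2] -/
theorem exists_stabilising [Finite M] (U : 𝒱 → Module.End R M) (hc : ∀ v w, U v * U w = U w * U v) :
    ∃ P : Module.End R M,
      (∀ g : Module.End R M, (∀ v, g * U v = U v * g) → P * g = g * P) ∧
      LinearMap.range P ≤ (⨅ v, ⨅ m, LinearMap.range (U v ^ m) : Submodule R M) ∧
      Set.BijOn P (⨅ v, ⨅ m, LinearMap.range (U v ^ m) : Submodule R M)
        (⨅ v, ⨅ m, LinearMap.range (U v ^ m) : Submodule R M) := by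
  classical
  obtain ⟨n, hn⟩ := exists_forall_iInf_range_pow_eq U
  have hcomm : ∀ v w, Commute (U v ^ n) (U w ^ n) := fun v w => (show Commute (U v) (U w) from hc v w).pow_pow n n
  set P : Module.End R M := Finset.univ.noncommProd (fun v => U v ^ n) fun v _ w _ _ => hcomm v w with hP
  refine ⟨P, fun g hg => ?_, ?_, ?_⟩
  · exact (Finset.noncommProd_commute _ _ _ g fun v _ => (show Commute g (U v) from hg v).pow_right n).eq.symm
  · refine le_iInf fun v => ?_
    rw [hn v n le_rfl, hP, ← Finset.mul_noncommProd_erase _ (Finset.mem_univ v), Module.End.mul_eq_comp]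
    exact LinearMap.range_comp_le_range _ _
  · set S : Set M := ((⨅ v, ⨅ m, LinearMap.range (U v ^ m) : Submodule R M) : Set M) with hS
    have hfac : ∀ v, Set.InjOn (U v ^ n) S ∧ Set.MapsTo (U v ^ n) S S := fun v => by
      have hb := bijOn_iInf U hc v
      have hit : Set.BijOn ((U v : M → M)^[n]) S S := hb.iterate n
      rw [← Module.End.coe_pow] at hit
      exact ⟨hit.injOn, hit.mapsTo⟩
    obtain ⟨hinj, hmaps⟩ := injOn_noncommProd Finset.univ (fun v => U v ^ n) (fun v _ w _ _ => hcomm v w) S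
      (fun v _ => (hfac v).2) (fun v _ => (hfac v).1)
    exact ((Set.toFinite S).injOn_iff_bijOn_of_mapsTo hmaps).1 hinj

/-- **`Ord ∩ (∑_i G_i M) = ∑_i G_i Ord`** for operators `G_i` commuting with the `U_v` (finite `M`):
an `x ∈ Ord` of the form `∑_i G_i y_i` is `∑_i G_i z_i` with `z_i ∈ Ord`. [cite: Hida1994AIF, §2] -/
theorem exists_forall_mem_iInf_eq_sum [Finite M] (U : 𝒱 → Module.End R M) (hc : ∀ v w, U v * U w = U w * U v)
    {ι : Type} (s : Finset ι) (G : ι → Module.End R M) (hG : ∀ i v, G i * U v = U v * G i)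
    {x : M} (hx : x ∈ (⨅ v, ⨅ m, LinearMap.range (U v ^ m) : Submodule R M)) (y : ι → M)
    (hxy : x = ∑ i ∈ s, G i (y i)) :
    ∃ z : ι → M, (∀ i, z i ∈ (⨅ v, ⨅ m, LinearMap.range (U v ^ m) : Submodule R M)) ∧ x = ∑ i ∈ s, G i (z i) := by
  obtain ⟨P, hPg, hPrange, hPbij⟩ := exists_stabilising U hc
  -- `z_i ∈ Ord` with `P z_i = P y_i`
  have hz : ∀ i, ∃ z ∈ (⨅ v, ⨅ m, LinearMap.range (U v ^ m) : Submodule R M), P z = P (y i) := fun i =>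
    hPbij.surjOn (hPrange (LinearMap.mem_range_self P (y i)))
  choose z hzmem hzP using hz
  have hGmaps : ∀ i, ∀ w ∈ (⨅ v, ⨅ m, LinearMap.range (U v ^ m) : Submodule R M),
      G i w ∈ (⨅ v, ⨅ m, LinearMap.range (U v ^ m) : Submodule R M) := fun i w hw => by
    simp only [Submodule.mem_iInf] at hw ⊢
    intro v
    exact (Submodule.mem_iInf _).1 (BigHeckeGLn.mapsTo_iInf_range_pow_of_comp_eq
      (U := U v) (U' := U v) (f := G i) (by rw [← Module.End.mul_eq_comp, ← Module.End.mul_eq_comp, hG i v])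
      ((Submodule.mem_iInf _).2 (hw v))) 
  refine ⟨z, hzmem, hPbij.injOn hx (Submodule.sum_mem _ fun i _ => hGmaps i _ (hzmem i)) ?_⟩
  rw [map_sum, hxy, map_sum]
  refine Finset.sum_congr rfl fun i _ => ?_
  have h1 : P (G i (y i)) = G i (P (y i)) := by
    rw [← Module.End.mul_apply, hPg (G i) (hG i), Module.End.mul_apply]
  have h2 : P (G i (z i)) = G i (P (z i)) := by
    rw [← Module.End.mul_apply, hPg (G i) (hG i), Module.End.mul_apply]
  rw [h1, h2, hzP]

end OrdFinite

end Literature.NumberTheory.Automorphic
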